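import Mathlib

/-!
# Sketch (stub-ideation k2 · g25) — `stub_cmLambdaLower` of crux `ResidualThetaCountLowerPureAtTwo` (stmt-BirchSwinnertonDyer-26074)

TARGET ATOM: the provenance of the (i)-half print clause **H-BKρ** = `KatoBKCoord ∧ CoordNondeg` of the KZ_g hold-opening
(child A `KatoZetaValuedClassCMAtTwo` of item 24105; texts of record `…Theorems.OnePair.OnePairPins.KatoBKCoord / CoordNondeg`,
p714847), i.e. the ONE step flagged «folklore, no numbered statement read yet» by the route pen (KZG-HOLD-OPENING-SCOPE-g19 §1 A2)
and by the stub-critic (STUB-PLAN rev 26.3 V126 (5)): «transport along Θ ⊗ ℚ».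

THESIS OF THIS SKETCH (typed dictionary, literature transfer): the transport needs NO classification of rank-2 weakly admissible
modules and NO full faithfulness of `D_cris`; it is FUNCTORIALITY ONLY —
  (N) naturality of the Bloch–Kato exponential in the representation ([BlochKato1990] Def. 3.10: `exp_V` = connecting map of
      `V ⊗ (0 → ℚ_p → B_cris^{φ=1} ⊕ B_dR⁺ → B_dR → 0)`), applied to the `ℚ₂[G_{ℚ₂}]`-linear coordinate embedding
      `θ_i := Θ_V⁻¹ ∘ incl_i : V₂W → V_ρ` induced by the crux binder `Θ` on Tate modules;
  (E) [BlochKato1990] Ex. 3.10.1 (formal Lie group of finite height: Kummer boundary = `exp_V ∘` Lie logarithm) for `Ŵ/ℤ₂`;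
  (A) the defining adjunction of `exp*` ([Delbourgo2008] p. 45: `Tr_{K/ℚ_p}(exp*(x) ∪_dR v) = inv_K(x ∪ exp(v))`;
      [Kato2004] §9.3 p. 187: `exp*` is a composite of natural maps; [Kobayashi2006] p. 571: `(x,z)_{E,n} = Tr log_Ê(x)·exp*_ω(z)`);
  (L) [Kato2004] Thm. 12.4/12.5 p. 221 are stated for ANY `Gal(ℚ̄/ℚ)`-stable `O_λ`-lattice `T` of `V_{F_λ}(f)` — so for `j(T_ρ)`,
      `j : V_ρ ≅ V_{F_λ}(g)(1)` the global identification (Chebotarev + Brauer–Nesbitt + irreducibility);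
  (D) `tan(V_ρ) := D_dR(V_ρ)/Fil⁰` is an `F_λ`-LINE: `D_dR(Θ_V)` is a filtered isomorphism `D_dR(V_ρ) ≅ D_dR(V₂W)ⁿ`, so
      `dim_{ℚ₂} tan(V_ρ) = n · dim tan(V₂W) = n = f = [F_λ : ℚ₂]` (the crux forces `n = f`), and the tower law gives `F_λ`-rank 1
      (`finrank_eq_one_of_finrank_restrictScalars` below).
  DEFINITION of the transport datum: `gr(D_dR θ_i)(ω_W^*) = c′_i · ω_g^*` with `c′_i ∈ F_λ` (exists uniquely by (D)).
  CONSEQUENCES typed below: §1 the pairing formula in coordinate `i` is `ε · log_ω(Q) · c′_i` read through `t₀(a · –)` and the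
  dual family `bO` — LITERALLY the right-hand side shape of `KatoBKCoord` (`Σ_j t₀(c′_i a bO_j) · (Galois sum of log(Q)·w_j)`),
  §2 the layer/trace bookkeeping in `F ⊗_K L`, §3 (ND): the `c′_i` form a `ℚ₂`-basis of `F_λ` BECAUSE `gr(D_dR Θ_V⁻¹)` is an
  isomorphism of `n`-dimensional `ℚ₂`-spaces onto the `F_λ`-line (`exists_basis_of_coords_on_line`), and the field-level
  equivalence `CoordNondeg ⇔ span_{ℚ₂}{c′_i} = F_λ` (`injective_coords_iff_span_eq_top`) for ANY non-zero functional `t₀`.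
  So «ONE a ∈ F_λˣ» (the pen's wording) holds iff `Θ_V` is `F_λ`-linear; for the crux's merely additive, `D₂`-equivariant `Θ`
  the invariant is the basis `c′` (k4-g21's ∃-bound `c′`, now EXPLAINED), ranging over a `GL_n(ℤ₂) × 𝒪ˣ`-orbit.

Everything here is Mathlib-only linear algebra (the tree has no `D_dR`); the p-adic Hodge theory inputs are the cited numbered
statements, consumed as the hypotheses `hNat` (N), `hAdj` (A), the basis `e` (D) of the lemmas. 0 sorry · 0 def · 0 instance ·
0 notation. BSD is NOT proved by any of this; RSL_g (22608), (R≥)ᵖ (26074), KZ_g (24105) stay OPEN / HOLD; nothing is claimed,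
re-typed or proposed.
-/

set_option autoImplicit false
set_option linter.dupNamespace false

namespace Summit.BirchSwinnertonDyer.BirchSwinnertonDyer.Cruxes.ResidualThetaCountLowerPureAtTwo.SideaK2G25

open scoped TensorProduct

/-! ## §1 Transport of the Bloch–Kato pairing formula along ONE Θ-coordinate
`K = ℚ₂`, `F = F_λ`; W-side (`K`-linear): `HW = H¹(ℚ₂, V₂W)`, `DW = tan(V₂W) = K·ω_W^*`, `expW` = BK exponential = Lie exp ∘ Kummer (E);
ρ-side (`F`-linear): `Hρ = H¹(ℚ₂, V_ρ)`, `Dρ = tan(V_ρ)`, `Cρ = Fil⁰ D_dR(V_ρ) = F·ω_g`, `expρ`, `expStar`, the `F`-valued Tate pairing `B`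
(cup product for the frame's symplectic form `s ∧ t`, `OnePairPins.hePk`) and the de Rham pairing `P` with `P ω_g ω_g^* = 1`;
`θH = H¹(θ_i)`, `θD = gr D_dR(θ_i)`; `hNat` = (N), `hAdj` = (A). -/
section Transport

variable {K F : Type*} [Field K] [Field F] [Algebra K F]
variable {HW DW : Type*} [AddCommGroup HW] [Module K HW] [AddCommGroup DW] [Module K DW]
variable {Hρ Dρ Cρ : Type*} [AddCommGroup Hρ] [Module F Hρ] [Module K Hρ]
  [AddCommGroup Dρ] [Module F Dρ] [Module K Dρ] [IsScalarTower K F Dρ] [AddCommGroup Cρ] [Module F Cρ]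

/-- **T1 (transport formula).** If `exp` is natural along the coordinate map `θ_i` (N) and `exp*` is the `P`-transpose of `exp` (A),
then the Tate pairing of `z ∈ H¹(V_ρ)` with the transported Kummer class of a formal point `Q` (`expW (log_ω(Q) • ω_W^*)`, (E)) is
`ε · log_ω(Q) · c′_i`, where `exp*(z) = ε·ω_g` and `gr D_dR(θ_i)(ω_W^*) = c′_i·ω_g^*`. No uniqueness of filtered `φ`-modules is used.
[cite: BlochKato1990, Def. 3.10 and Ex. 3.10.1 (pp. 359–360)] [cite: Delbourgo2008, p. 45] [cite: Kato2004Asterisque, §9.3 (p. 187)] -/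
theorem pairing_transport_eq
    (expW : DW →ₗ[K] HW) (expρ : Dρ →ₗ[F] Hρ) (θH : HW →ₗ[K] Hρ) (θD : DW →ₗ[K] Dρ)
    (hNat : ∀ x, θH (expW x) = expρ (θD x))
    (B : Hρ →ₗ[F] Hρ →ₗ[F] F) (expStar : Hρ →ₗ[F] Cρ) (P : Cρ →ₗ[F] Dρ →ₗ[F] F)
    (hAdj : ∀ z y, B z (expρ y) = P (expStar z) y)
    (ωW : DW) (ωD : Dρ) (ωC : Cρ) (hP : P ωC ωD = 1)
    (c' : F) (hc : θD ωW = c' • ωD) (z : Hρ) (ε : F) (hε : expStar z = ε • ωC) (ℓ : K) :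
    B z (θH (expW (ℓ • ωW))) = ε * algebraMap K F ℓ * c' := by
  have h1 : θD (ℓ • ωW) = (algebraMap K F ℓ * c') • ωD := by
    rw [map_smul, hc, ← algebraMap_smul F ℓ (c' • ωD), smul_smul]
  rw [hNat, h1, hAdj, hε]
  simp only [map_smul, LinearMap.smul_apply, hP, smul_eq_mul, mul_one]
  ring

/-- **T2 (the `KatoBKCoord` shape at the base layer).** Reading T1 through the pin functional `t₀` after scaling the class by
`a ∈ 𝒪` (the pinned `ℤ₂`-valued pairing is `t₀ ∘ ⟨a·z, –⟩_F`, `OnePairPins.hePk`) and expanding `ε = Σ_j w_j bO_j` in the dual family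
`bO` gives `Σ_j t₀(c′_i · a · bO_j) · (log_ω(Q) · w_j)` — the literal right-hand side of `KatoBKCoord` with the constants
`t₀(c′_i a bO_j)` OUTSIDE the (here trivial) Galois sums (k4-g21 (F3)). [cite: Kato2004Asterisque, Thm. 12.5 (1) (p. 221)] -/
theorem pairing_transport_read (t₀ : F →ₗ[K] K) {ι : Type*} [Fintype ι] (bO : ι → F) (w : ι → K)
    (a c' ε : F) (ℓ : K) (hε : ε = ∑ j, w j • bO j) :
    t₀ (a * (ε * algebraMap K F ℓ * c')) = ∑ j, t₀ (c' * a * bO j) * (ℓ * w j) := by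
  subst hε
  simp only [Finset.sum_mul, Finset.mul_sum, map_sum]
  refine Finset.sum_congr rfl fun j _ => ?_
  have h : a * (w j • bO j * algebraMap K F ℓ * c') = (ℓ * w j) • (c' * a * bO j) := by
    rw [Algebra.smul_def, Algebra.smul_def, map_mul]
    ring
  rw [h, map_smul, smul_eq_mul, mul_comm]

/-- **T1 ∘ T2 assembled**: the coordinate-`i` pairing read through `t₀(a · –)` IS the recombined sum. -/
theorem pairing_transport_coord
    (expW : DW →ₗ[K] HW) (expρ : Dρ →ₗ[F] Hρ) (θH : HW →ₗ[K] Hρ) (θD : DW →ₗ[K] Dρ)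
    (hNat : ∀ x, θH (expW x) = expρ (θD x))
    (B : Hρ →ₗ[F] Hρ →ₗ[F] F) (expStar : Hρ →ₗ[F] Cρ) (P : Cρ →ₗ[F] Dρ →ₗ[F] F)
    (hAdj : ∀ z y, B z (expρ y) = P (expStar z) y)
    (ωW : DW) (ωD : Dρ) (ωC : Cρ) (hP : P ωC ωD = 1)
    (c' : F) (hc : θD ωW = c' • ωD) (z : Hρ) (t₀ : F →ₗ[K] K) {ι : Type*} [Fintype ι] (bO : ι → F) (w : ι → K)
    (ε : F) (hε : ε = ∑ j, w j • bO j) (hz : expStar z = ε • ωC) (a : F) (ℓ : K) :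
    t₀ (a * B z (θH (expW (ℓ • ωW)))) = ∑ j, t₀ (c' * a * bO j) * (ℓ * w j) := by
  rw [pairing_transport_eq expW expρ θH θD hNat B expStar P hAdj ωW ωD ωC hP c' hc z ε hz ℓ]
  exact pairing_transport_read t₀ bO w a c' ε ℓ hε

end Transport

/-! ## §2 Layer bookkeeping: values in `F ⊗_K L` (`L = ℚ_{2,m}` a cyclotomic layer), trace `Tr = Σ_b τ_b`
At layer `m`, `exp*(z_m) = ε_m · ω_g` with `ε_m ∈ F ⊗_K L`, the adjunction (A) carries `id_F ⊗ Tr_{L/K}`, and the pinned pairing is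
`t₀ ∘ (id ⊗ Tr)`. The two lemmas say: that composite functional is `mul ∘ (t₀ ⊗ Tr)`, and on `(x ⊗ ℓ) · Σ_j bO_j ⊗ w_j` it is
`Σ_j t₀(x bO_j) · Tr(ℓ w_j)` — the `KatoBKCoord` right-hand side with `x = c′_i a`, `ℓ = log_ω(Q)`, `Tr(ℓ w_j) = Σ_b τ_b • (log(Q) w_j)`. -/
section Layer

variable {K F L : Type*} [Field K] [CommRing F] [Algebra K F] [CommRing L] [Algebra K L]

/-- **R0.** `t₀ ∘ (id_F ⊗ Tr) = mul ∘ (t₀ ⊗ Tr)` on `F ⊗_K L`. [cite: Delbourgo2008, p. 45] -/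
theorem t0_idTensorTrace_eq (t₀ : F →ₗ[K] K) (Tr : L →ₗ[K] K) (u : F ⊗[K] L) :
    t₀ (TensorProduct.rid K F (LinearMap.lTensor F Tr u)) = LinearMap.mul' K K (TensorProduct.map t₀ Tr u) := by
  induction u using TensorProduct.induction_on with
  | zero => simp
  | tmul f l => simp [TensorProduct.rid_tmul, mul_comm]
  | add u v hu hv => simp [map_add, hu, hv]

/-- **R1 (recombination at a layer).** `(mul ∘ (t₀ ⊗ Tr))((x ⊗ ℓ) · Σ_j bO_j ⊗ w_j) = Σ_j t₀(x · bO_j) · Tr(ℓ · w_j)`.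
[cite: Kato2004Asterisque, Thm. 12.5 (1) (p. 221)] [cite: Kobayashi2003, (8.23) (p. 18)] -/
theorem trace_read_recombine (t₀ : F →ₗ[K] K) (Tr : L →ₗ[K] K) {ι : Type*} [Fintype ι]
    (bO : ι → F) (w : ι → L) (x : F) (ℓ : L) :
    LinearMap.mul' K K (TensorProduct.map t₀ Tr ((x ⊗ₜ[K] ℓ) * ∑ j, bO j ⊗ₜ[K] w j)) =
      ∑ j, t₀ (x * bO j) * Tr (ℓ * w j) := by
  simp [Finset.mul_sum, Algebra.TensorProduct.tmul_mul_tmul, map_sum, TensorProduct.map_tmul]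

end Layer

/-! ## §3 (ND) — why print supplies `CoordNondeg`: `c′` is a `ℚ₂`-basis of `F_λ` because `gr D_dR(Θ_V⁻¹)` is an ISOMORPHISM
`⊕_i ℚ₂·ω_{W,i}^* ≅ tan(V_ρ) = F_λ·ω_g^*`; and `CoordNondeg ⇔ span_{ℚ₂}{c′_i} = F_λ` for any non-zero `t₀`. -/
section ND

variable (K F D : Type*) [Field K] [Field F] [Algebra K F]
  [AddCommGroup D] [Module F D] [Module K D] [IsScalarTower K F D]

/-- **N0 (the tangent space of `V_ρ` is an `F_λ`-line).** If `dim_K D = [F : K]` (here: `dim_{ℚ₂} tan(V_ρ) = n·dim tan(V₂W) = n = f`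
through the filtered isomorphism `D_dR(Θ_V)`), then `dim_F D = 1` (tower law). [cite: BlochKato1990, Ex. 3.10.1 (p. 359)] -/
theorem finrank_eq_one_of_finrank_restrictScalars [FiniteDimensional K F] (h : Module.finrank K D = Module.finrank K F) :
    Module.finrank F D = 1 := by
  have hmul := Module.finrank_mul_finrank K F D
  rw [h] at hmul
  exact Nat.eq_of_mul_eq_mul_left Module.finrank_pos (hmul.trans (Nat.mul_one _).symm)

variable {K F D}

/-- **N1 (graded iso ⇒ basis).** On an `F`-line `D = F·ω`, a `K`-basis `e` of `D` (the image of the coordinate tangent vectors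
`ω_{W,i}^*` under the isomorphism `gr D_dR(Θ_V⁻¹)`) has coordinates `c′` (`e_i = c′_i·ω`) forming a `K`-basis of `F`. This is the
print-side reason the hold-opening's `∃ c′, … ∧ CoordNondeg π c′` is inhabited. -/
theorem exists_basis_of_coords_on_line {n : ℕ} (ω : D) (hω : ω ≠ 0) (hline : ∀ d : D, ∃ c : F, c • ω = d)
    (e : Module.Basis (Fin n) K D) (c' : Fin n → F) (hc : ∀ i, e i = c' i • ω) :
    ∃ b : Module.Basis (Fin n) K F, ∀ i, b i = c' i := by
  let φ₀ : F →ₗ[K] D := (LinearMap.toSpanSingleton F D ω).restrictScalars K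
  have hφ₀ : ∀ a : F, φ₀ a = a • ω := fun a => rfl
  have hinj : Function.Injective φ₀ := by
    intro a b hab
    rw [hφ₀, hφ₀] at hab
    exact smul_left_injective F hω hab
  have hsurj : Function.Surjective φ₀ := fun d => by
    obtain ⟨c, hc⟩ := hline d
    exact ⟨c, by rw [hφ₀, hc]⟩
  let φ : F ≃ₗ[K] D := LinearEquiv.ofBijective φ₀ ⟨hinj, hsurj⟩
  refine ⟨e.map φ.symm, fun i => ?_⟩
  apply φ.injective
  rw [Module.Basis.map_apply, LinearEquiv.apply_symm_apply, hc i]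
  exact (hφ₀ (c' i)).symm

/-- **N2 (field-level `CoordNondeg ⇔` basis).** For ANY non-zero `K`-linear functional `t₀` on the field `F` (the form
`(x, y) ↦ t₀(xy)` is then non-degenerate — no separability needed) and any family `c′`: the coordinate map
`a ↦ (t₀(c′_i a))_i` is injective iff the `c′_i` span `F` over `K`. (⇐) is the supply direction (print ⇒ `CoordNondeg`, via N1);
(⇒) is k4-g21's H-A4 (consumed by the recombination). The tree's `CoordNondeg` is the `𝒪`-integral form (`t₀ : 𝒪 →+ ℤ₂`);
injectivity there ⇔ injectivity here since `𝒪` is `2`-torsion-free and spans `F_λ`. -/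
theorem injective_coords_iff_span_eq_top [FiniteDimensional K F] {n : ℕ} (t₀ : F →ₗ[K] K) (ht₀ : t₀ ≠ 0) (c' : Fin n → F) :
    Function.Injective (fun a : F => fun i : Fin n => t₀ (c' i * a)) ↔ Submodule.span K (Set.range c') = ⊤ := by
  -- the trace-like form of a non-zero functional on a field is non-degenerate
  have key : ∀ d : F, (∀ s : F, t₀ (s * d) = 0) → d = 0 := by
    intro d hd
    by_contra hne
    apply ht₀
    ext f
    have := hd (f / d)
    rwa [div_mul_cancel₀ f hne] at this
  -- `Ψ d = t₀(– · d)`, a `K`-linear map `F → Dual_K F`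
  let Ψ : F →ₗ[K] Module.Dual K F := (LinearMap.mul K F).flip.compr₂ t₀
  have hΨ : ∀ d s : F, Ψ d s = t₀ (s * d) := fun d s => by
    simp [Ψ, LinearMap.compr₂_apply, mul_comm]
  have hΨinj : Function.Injective Ψ := by
    rw [← LinearMap.ker_eq_bot, LinearMap.ker_eq_bot']
    intro d hd
    exact key d fun s => by rw [← hΨ, hd, LinearMap.zero_apply]
  have hΨsurj : Function.Surjective Ψ :=
    (LinearMap.injective_iff_surjective_of_finrank_eq_finrank (Subspace.dual_finrank_eq).symm).mp hΨinj
  constructor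
  · intro hinj
    by_contra hne
    obtain ⟨ψ, hψ0, hψ⟩ := Submodule.exists_le_ker_of_lt_top _ (lt_top_iff_ne_top.mpr hne)
    obtain ⟨d, rfl⟩ := hΨsurj ψ
    have hd0 : d ≠ 0 := by
      rintro rfl
      exact hψ0 (map_zero Ψ)
    refine hd0 (hinj (a₁ := d) (a₂ := 0) (funext fun i => ?_))
    have hi : Ψ d (c' i) = 0 := LinearMap.mem_ker.mp (hψ (Submodule.subset_span ⟨i, rfl⟩))
    rw [hΨ] at hi
    simp [hi]
  · intro hspan a b hab
    have hd : ∀ i, t₀ (c' i * (a - b)) = 0 := fun i => by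
      have := congr_fun hab i
      simp only at this
      rw [mul_sub, map_sub, this, sub_self]
    -- the annihilator of `a - b` under the form is a subspace containing every `c′_i`, hence everything
    have hle : Submodule.span K (Set.range c') ≤ LinearMap.ker (Ψ (a - b)) :=
      Submodule.span_le.mpr (Set.range_subset_iff.mpr fun i => by
        rw [SetLike.mem_coe, LinearMap.mem_ker, hΨ]; exact hd i)
    rw [hspan, top_le_iff, LinearMap.ker_eq_top] at hle
    exact sub_eq_zero.mp (key _ fun s => by rw [← hΨ, hle, LinearMap.zero_apply])

/-- **N1 + N2: print ⇒ the field-level `CoordNondeg`.** -/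
theorem injective_coords_of_coords_on_line [FiniteDimensional K F] {n : ℕ} (ω : D) (hω : ω ≠ 0) (hline : ∀ d : D, ∃ c : F, c • ω = d)
    (e : Module.Basis (Fin n) K D) (c' : Fin n → F) (hc : ∀ i, e i = c' i • ω) (t₀ : F →ₗ[K] K) (ht₀ : t₀ ≠ 0) :
    Function.Injective (fun a : F => fun i : Fin n => t₀ (c' i * a)) := by
  obtain ⟨b, hb⟩ := exists_basis_of_coords_on_line ω hω hline e c' hc
  rw [injective_coords_iff_span_eq_top t₀ ht₀]
  have : Set.range c' = Set.range b := by
    ext x; constructor <;> rintro ⟨i, rfl⟩ <;> exact ⟨i, by rw [hb i]⟩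
  rw [this, b.span_eq]

/-- **N3 (integral ⇔ rational injectivity).** The tree's `CoordNondeg π c′` is injectivity of the `ℤ₂`-integral coordinate map
`g : 𝒪 → ℤ₂ⁿ`; its `⊗ ℚ₂` version is `h : F_λ → ℚ₂ⁿ` (N2's map). For a commuting square `h ∘ ι = κ ∘ g` with `ι : 𝒪 ↪ F_λ`,
`κ : ℤ₂ⁿ ↪ ℚ₂ⁿ` injective and `F_λ = ℤ[1/2]·ι(𝒪)` torsion-free, the two injectivities are equivalent — so N1 + N2 (+ k4-g21's
2-power renormalisation putting `c′` in `𝒪ⁿ`) deliver the integral clause. Pure additive algebra. -/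
theorem injective_integral_iff_rational {O F' M N : Type*} [AddCommGroup O] [AddCommGroup F'] [AddCommGroup M]
    [AddCommGroup N] [NoZeroSMulDivisors ℕ F'] (ι : O →+ F') (κ : M →+ N) (g : O →+ M) (h : F' →+ N)
    (hcomm : ∀ a, h (ι a) = κ (g a)) (hι : Function.Injective ι) (hκ : Function.Injective κ)
    (hsat : ∀ x : F', ∃ m : ℕ, m ≠ 0 ∧ ∃ a : O, m • x = ι a) :
    Function.Injective g ↔ Function.Injective h := by
  constructor
  · intro hg x y hxy
    rw [← sub_eq_zero]
    obtain ⟨m, hm, a, ha⟩ := hsat (x - y)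
    have h0 : h (ι a) = 0 := by rw [← ha, map_nsmul, map_sub, hxy, sub_self, smul_zero]
    rw [hcomm] at h0
    have hga : g a = 0 := hκ (by rw [h0, map_zero])
    have ha0 : a = 0 := hg (by rw [hga, map_zero])
    rw [ha0, map_zero] at ha
    exact (smul_eq_zero.mp ha).resolve_left hm
  · intro hh a b hab
    apply hι
    apply hh
    rw [hcomm, hcomm, hab]

end ND

end Summit.BirchSwinnertonDyer.BirchSwinnertonDyer.Cruxes.ResidualThetaCountLowerPureAtTwo.SideaK2G25
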